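import Literature.Probability.Percolation.GladkovThreeClusterDichotomyProofs
import Mathlib.Tactic.Linarith
import HarnessLib

/-!
# `NoHeavyLowerTail` (stmt-CriticalPhenomena-4575) — the two-seal switching bound for the apex-pair row APL:
# `P(x|y|z)·P(xyz) ≤ P(xy|z) + P(xz|y) + P(BLOCKED)`

Support file (prover seat `prim-ineq-gen-8`, gen 30; `--supports stmt-CriticalPhenomena-4575`; memo
`run/shared/lean/prim/prim-ineq-gen-8/FINDING-gen30-APL-SWITCHING.md` §1).  No definitions, no named facts, no sorries.

SETTING (combinatorial, as in `GladkovThreeClusterDichotomyProofs` and the gen-28 companion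
`PercNearOneGluingNoHeavyLowerTailAPLSwitching.lean`): configurations are finite sets of open pairs `K ⊆ Sym2 V` of a
finite vertex type weighted by `wtW univ p`; `PrW` / `Pr2W` are the probabilities of events of one / of a pair of
independent configurations `(C₁, C₂)`; `cl K x` is the open cluster `Com_x`; `touch W` the pairs meeting `W`;
`tri x y z = x|y|z`; `splice S C₁ C₂ = C₁ →_S C₂` [cite: Gladkov2024, Def. 2.3, Lemma 3.1] [cite: GladkovZimin2024, §4, Lemma 4.2].

THE SEAL HYBRID.  For a vertex `y`, `C₁ →_{touch Com_y(C₁)} C₂` keeps `C₁` on every pair meeting the `C₁`-cluster of `y`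
and takes `C₂` elsewhere; it is `μ`-distributed (`APL.Pr2W_seal_law`, an instance of `DecisionTree.Pr2W_splice_law`:
explore `Com_y` in `C₁` into `S`, everything else into `S̄`), its cluster of `y` is `Com_y(C₁)` (`APL.cl_splice_touch_cl`),
and off that star it contains `C₂ ∖ touch Com_y(C₁)` (`APL.sdiff_touch_subset_splice`).  Hence (`APL.splice_touch_mem_pair`):
if `y ∉ Com_x(C₁)` and `C₂` joins `x` to `z` by an open path AVOIDING the vertex set `Com_y(C₁)` — i.e.
`z ∈ cl (C₂ ∖ touch Com_y(C₁)) x` — then the hybrid lies in `xz|y`.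

WHAT IS PROVED (the linear book-keeping behind the conjectured reverse-Harris row
`APL₁(κ): P(xy|z) + P(xz|y) ≥ κ·P(x|y|z)·P(xyz)` — OPEN; three-port `Z(3,2)` needs `κ > 0.2046`):
* `APL.Pr2W_avoid_le_pair` — `P(C₁ ∈ {y ∉ Com_x}, x ↔ z in C₂ off Com_y(C₁)) ≤ P(xz|y)`;
* `APL.PrW_tri_mul_PrW_conn₂_le` — **`P(x|y|z)·P(xyz) ≤ P(xy|z) + P(xz|y) + P(BLOCKED)`**, where
  `BLOCKED = {(C₁, C₂) : C₁ ∈ x|y|z, C₂ ∈ xyz, every C₂-open x–z path meets Com_y(C₁), every C₂-open x–y path meets Com_z(C₁)}`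
  (written with clusters of the pruned configurations `C₂ ∖ touch Com_y(C₁)`, `C₂ ∖ touch Com_z(C₁)`).
So `APL₁(κ)` for a weighted graph is EQUIVALENT up to constants to `P(BLOCKED) ≤ (1/κ − 1)·(P(xy|z)+P(xz|y))`; on the
`V`/triangle family `BLOCKED = ∅` (whence `inf e/(u0·u3) ≤ 1` is attained there), on the sparse-apex `K_{3,k}` family
`P(BLOCKED)/e → r(1−r)(1−(1−r²)^{k−1}) ≤ 1/4` (memo §1).  Compare the gen-28 bound
`APL.iso_mul_conn_le_pairs_add_glued` (`P(x|y ∩ x|z)·P(xy ∪ xz) ≤ e + P(C₁ ∈ x|yz, H₃ ∈ xyz)`), whose remainder is a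
mixed `S₃`-hybrid event; here the remainder is an explicit vertex-cut condition on the independent pair.  [this work]
-/

namespace Summit.CriticalPhenomena.PercolationContinuityZ3.Theorems

namespace APL

open Literature.Probability.Percolation Literature.Probability.Percolation.Gladkov
  Literature.Probability.Percolation.DecisionTree
open scoped Classical

variable {V : Type*} [Fintype V] [DecidableEq V]

section Pointwise

/-- **The seal hybrid keeps the sealed cluster**: `Com_y(C₁ →_{touch Com_y(C₁)} C₂) = Com_y(C₁)`.
[cite: GladkovZimin2024, §4 (Example 4.4: a cluster is determined by the edges touching it)] [this work] -/
theorem cl_splice_touch_cl (y : V) (K₁ K₂ : Finset (Sym2 V)) :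
    cl (splice (touch (cl K₁ y)) K₁ K₂) y = cl K₁ y :=
  cl_eq_of_agree fun _ he => (mem_splice_of_mem he).symm

/-- Off the sealed star the hybrid contains the pruned second configuration: `C₂ ∖ touch W ⊆ C₁ →_{touch W} C₂`.
[cite: Gladkov2024, Def. 2.3] [this work] -/
theorem sdiff_touch_subset_splice (W : Finset V) (K₁ K₂ : Finset (Sym2 V)) :
    K₂ \ touch W ⊆ splice (touch W) K₁ K₂ := fun e he => by
  rw [Finset.mem_sdiff] at he
  exact (mem_splice_of_not_mem he.2).2 he.1

/-- **Good pairs switch into `xz|y`.**  If `y ∉ Com_x(C₁)` and `C₂` joins `x` to `z` by open pairs not meeting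
`Com_y(C₁)`, then the seal hybrid `H = C₁ →_{touch Com_y(C₁)} C₂` has `z ∈ Com_x(H)` and `y ∉ Com_x(H)`. [this work] -/
theorem splice_touch_mem_pair {x y z : V} {K₁ K₂ : Finset (Sym2 V)} (hxy : y ∉ cl K₁ x)
    (hz : z ∈ cl (K₂ \ touch (cl K₁ y)) x) :
    z ∈ cl (splice (touch (cl K₁ y)) K₁ K₂) x ∧ y ∉ cl (splice (touch (cl K₁ y)) K₁ K₂) x := by
  refine ⟨mem_cl.2 (reachable_mono (sdiff_touch_subset_splice (cl K₁ y) K₁ K₂) (mem_cl.1 hz)),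
    fun hy => ?_⟩
  have hx : x ∈ cl (splice (touch (cl K₁ y)) K₁ K₂) y := mem_cl_comm.1 hy
  rw [cl_splice_touch_cl] at hx
  exact hxy (mem_cl_comm.1 hx)

end Pointwise

section Switching

variable {p : Sym2 V → ℝ} (hp0 : ∀ i, 0 ≤ p i) (hp1 : ∀ i, p i ≤ 1) (x y z : V)

/-- **The seal hybrid is `μ`-distributed**: `P(C₁ →_{touch Com_y(C₁)} C₂ ∈ X) = P(X)` (explore `Com_y(C₁)` into `S`,
the rest into `S̄`). [cite: Gladkov2024, Lemma 3.1; GladkovZimin2024, Lemma 4.2] [this work] -/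
theorem Pr2W_seal_law (X : Set (Finset (Sym2 V))) :
    Pr2W Finset.univ p {w | splice (touch (cl w.1 y)) w.1 w.2 ∈ X} = PrW Finset.univ p X := by
  have h := Pr2W_splice_law Finset.univ p (R₁ := fun K : Finset (Sym2 V) => touch (cl K y))
    (R := fun K : Finset (Sym2 V) => touch (cl K y)) (S := fun _ => (∅ : Finset (Sym2 V)))
    (selfDetermined_touch_cl y) (selfDetermined_touch_cl y) (fun K => Finset.Subset.refl _)
    (fun _ => Finset.disjoint_empty_left _) (fun _ _ _ => rfl) X
  simpa only [Finset.union_empty] using h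

include hp0 hp1

/-- **Pairs with an avoiding path are few**: `P(y ∉ Com_x(C₁), z ∈ Com_x(C₂ ∖ touch Com_y(C₁))) ≤ P(xz|y)`.
[this work] -/
theorem Pr2W_avoid_le_pair :
    Pr2W Finset.univ p {w | y ∉ cl w.1 x ∧ z ∈ cl (w.2 \ touch (cl w.1 y)) x} ≤
      PrW Finset.univ p {K | z ∈ cl K x ∧ y ∉ cl K x} := by
  rw [← Pr2W_seal_law (p := p) y {K | z ∈ cl K x ∧ y ∉ cl K x}]
  exact Pr2W_mono _ hp0 hp1 fun w _ _ hw => splice_touch_mem_pair hw.1 hw.2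

/-- **Two-seal switching bound for APL₁.**
`P(x|y|z)·P(xyz) ≤ P(xy|z) + P(xz|y) + P(C₁ ∈ x|y|z, C₂ ∈ xyz, x ↮ z in C₂ off Com_y(C₁), x ↮ y in C₂ off Com_z(C₁))`:
the product event splits into pairs where `C₂` joins `x` to `z` avoiding `Com_y(C₁)` (sealing `Com_y(C₁)` switches them
into `xz|y`), pairs where `C₂` joins `x` to `y` avoiding `Com_z(C₁)` (into `xy|z`), and the doubly BLOCKED remainder.
[cite: Gladkov2024, Lemma 3.1] [this work] -/
theorem PrW_tri_mul_PrW_conn₂_le :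
    PrW Finset.univ p (tri x y z) * PrW Finset.univ p (conn x y ∩ conn x z) ≤
      PrW Finset.univ p {K | y ∈ cl K x ∧ z ∉ cl K x} + PrW Finset.univ p {K | z ∈ cl K x ∧ y ∉ cl K x} +
        Pr2W Finset.univ p {w | w.1 ∈ tri x y z ∧ w.2 ∈ conn x y ∩ conn x z ∧
          z ∉ cl (w.2 \ touch (cl w.1 y)) x ∧ y ∉ cl (w.2 \ touch (cl w.1 z)) x} := by
  rw [← Pr2W_prod]
  have hsplit : Pr2W Finset.univ p (tri x y z ×ˢ (conn x y ∩ conn x z)) ≤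
      Pr2W Finset.univ p
        (({w : Finset (Sym2 V) × Finset (Sym2 V) | z ∉ cl w.1 x ∧ y ∈ cl (w.2 \ touch (cl w.1 z)) x} ∪
            {w | y ∉ cl w.1 x ∧ z ∈ cl (w.2 \ touch (cl w.1 y)) x}) ∪
          {w | w.1 ∈ tri x y z ∧ w.2 ∈ conn x y ∩ conn x z ∧
            z ∉ cl (w.2 \ touch (cl w.1 y)) x ∧ y ∉ cl (w.2 \ touch (cl w.1 z)) x}) := by
    refine Pr2W_mono _ hp0 hp1 fun w _ _ hw => ?_
    obtain ⟨htri, hconn⟩ := Set.mem_prod.1 hw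
    by_cases hzx : z ∈ cl (w.2 \ touch (cl w.1 y)) x
    · exact Or.inl (Or.inr ⟨htri.1, hzx⟩)
    · by_cases hyx : y ∈ cl (w.2 \ touch (cl w.1 z)) x
      · exact Or.inl (Or.inl ⟨htri.2.1, hyx⟩)
      · exact Or.inr ⟨htri, hconn, hzx, hyx⟩
  have h1 := Pr2W_union_le Finset.univ hp0 hp1
    ({w : Finset (Sym2 V) × Finset (Sym2 V) | z ∉ cl w.1 x ∧ y ∈ cl (w.2 \ touch (cl w.1 z)) x} ∪
      {w | y ∉ cl w.1 x ∧ z ∈ cl (w.2 \ touch (cl w.1 y)) x})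
    {w | w.1 ∈ tri x y z ∧ w.2 ∈ conn x y ∩ conn x z ∧
      z ∉ cl (w.2 \ touch (cl w.1 y)) x ∧ y ∉ cl (w.2 \ touch (cl w.1 z)) x}
  have h2 := Pr2W_union_le Finset.univ hp0 hp1
    {w : Finset (Sym2 V) × Finset (Sym2 V) | z ∉ cl w.1 x ∧ y ∈ cl (w.2 \ touch (cl w.1 z)) x}
    {w | y ∉ cl w.1 x ∧ z ∈ cl (w.2 \ touch (cl w.1 y)) x}
  have hy := Pr2W_avoid_le_pair hp0 hp1 x y z
  have hz := Pr2W_avoid_le_pair hp0 hp1 x z y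
  linarith

end Switching

end APL

end Summit.CriticalPhenomena.PercolationContinuityZ3.Theorems
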